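import Summits.ValiantsHypothesis.ValiantsHypothesis.Theorems.DefinabilityGapLowDegreeRung
import HarnessLib

/-!
# DefinabilityGap — the TRADE certificate (initial forms with a degree budget) for the planted KI generator

Kernel support for `route-ValiantsHypothesis-DefinabilityGap`, item K1 (`KIPlantedHitting`, stmt-23547), clause
`b = 2` in its support form (decomp-valiant lens 5, gen 8, NODE v8 §B2). §1 (any monomial order `≺`, any nonzero
family `P_c`): if the `≺`-leading exponents `(M_c)_{c ∈ T}` admit NO nonzero integer trade `γ` (`Σ_c γ_c • M_c = 0`)
of positive mass `|γ⁺| ≤ d`, then every nonzero `D` with monomials in `T` and `deg D ≤ d` has `D ∘ P ≠ 0`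
(`hits_of_noShortTrade`; the case "no trade at all" is the linear-independence certificate of
`DefinabilityGapLexCertificate`). §2 (the planted generator `G_m`, `P_c = per_m(y|S_c)`): a cell weight `w` under
which every block `c ∈ T` has a UNIQUE maximum-weight perfect matching `σ_c` is realised by deg-lex after the
spreading substitution `y_p ↦ u_{p,0} ⋯ u_{p,w p}`, with leading exponent the pattern of `σ_c` (permanent
positivity), so "no short trade of the patterns" ⟹ hitting (`kiPer_hits_of_noShortTrade_weight`). §3: the
certificate as a predicate `TradeCertAt m s d` and the glue to support hitting (`supportHitting_of_tradeCert`; with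
`s = 2q²+1`, `d = q²` its conclusion is the lens node's `KISupportHitting 2`). The certificate itself is NOT claimed.
All statements are sorry-free and use only standard axioms.
-/

noncomputable section

open MvPolynomial
open Literature.Computability.AlgebraicComplexity Literature.Computability.MetaComplexity
open Summit.ValiantsHypothesis.ValiantsHypothesis.Theorems.DefinabilityGapAffineRung

namespace Summit.ValiantsHypothesis.ValiantsHypothesis.Theorems.DefinabilityGapTradeCertificate

/-! ## 1. Initial forms under an arbitrary monomial order (generic family) -/

section Generic

variable {ι τ : Type*} (o : MonomialOrder τ) (P : ι → MvPolynomial τ ℂ)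

/-- The `≺`-leading exponent of the power product `∏_c P_c^{e_c}`: `Σ_c e_c • deg_≺(P_c)`. [folklore] -/
def leadSumO (e : ι →₀ ℕ) : τ →₀ ℕ := e.sum fun c n => n • o.degree (P c)

/-- A term `a · ∏_c P_c^{e_c}` with `a ≠ 0` and all `P_c ≠ 0` is nonzero. [folklore] -/
theorem term_ne_zeroO (hP : ∀ c, P c ≠ 0) (e : ι →₀ ℕ) {a : ℂ} (ha : a ≠ 0) :
    bind₁ P (monomial e a) ≠ 0 := by
  rw [bind₁_monomial]
  exact mul_ne_zero (C_eq_zero.not.2 ha) (Finset.prod_ne_zero_iff.2 fun c _ => pow_ne_zero _ (hP c))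

/-- The `≺`-leading exponent of `a · ∏_c P_c^{e_c}` is `Σ_c e_c • deg_≺(P_c)`. [folklore] -/
theorem degree_termO (hP : ∀ c, P c ≠ 0) (e : ι →₀ ℕ) {a : ℂ} (ha : a ≠ 0) :
    o.degree (bind₁ P (monomial e a)) = leadSumO o P e := by
  classical
  have hprod : (∏ c ∈ e.support, P c ^ e c) ≠ 0 :=
    Finset.prod_ne_zero_iff.2 fun c _ => pow_ne_zero _ (hP c)
  rw [bind₁_monomial, o.degree_mul (C_eq_zero.not.2 ha) hprod, o.degree_C, zero_add,
    o.degree_prod (fun c _ => pow_ne_zero _ (hP c))]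
  simp_rw [o.degree_pow]
  rfl

/-- **Injectivity of leading sums ⟹ hitting** (any monomial order): if `e ↦ Σ_c e_c • deg_≺(P_c)` is injective on a
set `S` of exponents containing the support of `D ≠ 0`, then `D ∘ P ≠ 0`. [folklore] -/
theorem hits_of_injOn (hP : ∀ c, P c ≠ 0) (S : Set (ι →₀ ℕ)) (hinj : Set.InjOn (leadSumO o P) S)
    (D : MvPolynomial ι ℂ) (hD : D ≠ 0) (hS : ∀ e ∈ D.support, e ∈ S) : bind₁ P D ≠ 0 := by
  classical
  have hne : D.support.Nonempty := Finset.nonempty_iff_ne_empty.2 fun h => hD (support_eq_empty.1 h)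
  obtain ⟨e₀, he₀, hmax⟩ := Finset.exists_max_image D.support (fun e => o.toSyn (leadSumO o P e)) hne
  have key : coeff (leadSumO o P e₀) (bind₁ P D) =
      coeff (leadSumO o P e₀) (bind₁ P (monomial e₀ (coeff e₀ D))) := by
    conv_lhs => rw [D.as_sum, map_sum, coeff_sum]
    rw [Finset.sum_eq_single e₀]
    · intro e he hne'
      apply o.coeff_eq_zero_of_lt
      rw [degree_termO o P hP e (mem_support_iff.1 he)]
      exact lt_of_le_of_ne (hmax e he) fun h => hne' (hinj (hS e he) (hS e₀ he₀) (o.toSyn.injective h))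
    · exact fun h => absurd he₀ h
  intro h0
  rw [h0, coeff_zero] at key
  have hT0 := term_ne_zeroO P hP e₀ (mem_support_iff.1 he₀)
  apply (o.leadingCoeff_ne_zero_iff.2 hT0)
  show coeff (o.degree _) _ = 0
  rw [degree_termO o P hP e₀ (mem_support_iff.1 he₀)]
  exact key.symm

/-- Coordinates of the leading sum, over `ℤ`. [folklore] -/
theorem leadSumO_apply (e : ι →₀ ℕ) (x : τ) :
    ((leadSumO o P e x : ℕ) : ℤ) = ∑ c ∈ e.support, (e c : ℤ) * (o.degree (P c) x : ℤ) := by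
  rw [leadSumO, Finsupp.sum_apply, Finsupp.sum, Nat.cast_sum]
  refine Finset.sum_congr rfl fun c _ => ?_
  rw [Finsupp.smul_apply, smul_eq_mul, Nat.cast_mul]

/-- **No short trade ⟹ injectivity**: if the leading exponents `(deg_≺ P_c)_{c ∈ T}` admit no nonzero integer
trade of positive mass `≤ d`, then `e ↦ Σ_c e_c • deg_≺(P_c)` is injective on `{e : supp e ⊆ T, |e| ≤ d}`. [this file] -/
theorem injOn_of_noShortTrade (T : Finset ι) (d : ℕ)
    (hno : ∀ γ : ι → ℤ, (∀ c, c ∉ T → γ c = 0) → γ ≠ 0 →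
      (∀ x : τ, ∑ c ∈ T, γ c * (o.degree (P c) x : ℤ) = 0) → d < ∑ c ∈ T, (γ c).toNat) :
    Set.InjOn (leadSumO o P) {e | e.support ⊆ T ∧ (e.sum fun _ n => n) ≤ d} := by
  classical
  rintro e ⟨he, hed⟩ e' ⟨he', -⟩ h
  by_contra hne
  set γ : ι → ℤ := fun c => (e c : ℤ) - e' c with hγ
  have h0 : ∀ c, c ∉ T → γ c = 0 := fun c hc => by
    have h1 : e c = 0 := Finsupp.notMem_support_iff.1 fun h => hc (he h)
    have h2 : e' c = 0 := Finsupp.notMem_support_iff.1 fun h => hc (he' h)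
    simp [hγ, h1, h2]
  have hne0 : γ ≠ 0 := fun hz => hne (Finsupp.ext fun c => by
    simpa only [hγ, Pi.zero_apply, sub_eq_zero, Nat.cast_inj] using congrFun hz c)
  have hexp : ∀ (f : ι →₀ ℕ), f.support ⊆ T → ∀ x : τ,
      ((leadSumO o P f x : ℕ) : ℤ) = ∑ c ∈ T, (f c : ℤ) * (o.degree (P c) x : ℤ) := by
    intro f hf x
    rw [leadSumO_apply]
    exact Finset.sum_subset hf fun c _ hc => by rw [Finsupp.notMem_support_iff.1 hc]; simp
  have hsum : ∀ x : τ, ∑ c ∈ T, γ c * (o.degree (P c) x : ℤ) = 0 := by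
    intro x
    have hx : ((leadSumO o P e x : ℕ) : ℤ) = ((leadSumO o P e' x : ℕ) : ℤ) := by rw [h]
    rw [hexp e he, hexp e' he'] at hx
    simp_rw [hγ, sub_mul, Finset.sum_sub_distrib, hx, sub_self]
  have hlt := hno γ h0 hne0 hsum
  have hle : ∑ c ∈ T, (γ c).toNat ≤ e.sum fun _ n => n := by
    calc ∑ c ∈ T, (γ c).toNat ≤ ∑ c ∈ T, e c :=
          Finset.sum_le_sum fun c _ => Int.toNat_le.2 (by simp only [hγ]; omega)
      _ = e.sum fun _ n => n := by
          rw [Finsupp.sum, Finset.sum_subset he]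
          intro c _ hc
          exact Finsupp.notMem_support_iff.1 hc
  omega

/-- **Trade certificate ⟹ hitting (any monomial order)**: no nonzero trade of positive mass `≤ d` among the
leading exponents on `T` ⟹ every nonzero `D` with monomials in `T` and `deg D ≤ d` has `D ∘ P ≠ 0`. [this file] -/
theorem hits_of_noShortTrade (hP : ∀ c, P c ≠ 0) (T : Finset ι) (d : ℕ)
    (hno : ∀ γ : ι → ℤ, (∀ c, c ∉ T → γ c = 0) → γ ≠ 0 →
      (∀ x : τ, ∑ c ∈ T, γ c * (o.degree (P c) x : ℤ) = 0) → d < ∑ c ∈ T, (γ c).toNat)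
    (D : MvPolynomial ι ℂ) (hD : D ≠ 0) (hT : ∀ e ∈ D.support, e.support ⊆ T)
    (hdeg : D.totalDegree ≤ d) : bind₁ P D ≠ 0 :=
  hits_of_injOn o P hP _ (injOn_of_noShortTrade o P T d hno) D hD
    fun e he => ⟨hT e he, (le_totalDegree he).trans hdeg⟩

end Generic

/-! ## 2. Cell weights realised by a monomial order (spreading `y_p ↦ u_{p,0} ⋯ u_{p,w p}` + deg-lex) -/

section Weight

open OrderDual (toDual)

variable (m : ℕ)

/-- Injective coding of (cell, copy-index) pairs by naturals. [this file] -/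
def enc (x : (Fin (qOf m) × Fin (qOf m)) × ℕ) : ℕ := Nat.pairEquiv ((finProdFinEquiv x.1 : ℕ), x.2)

/-- `enc` is injective. [this file] -/
theorem enc_injective : Function.Injective (enc m) := by
  rintro ⟨p, j⟩ ⟨p', j'⟩ h
  obtain ⟨h2, h3⟩ := Prod.mk.inj (Nat.pairEquiv.injective h)
  exact Prod.ext (finProdFinEquiv.injective (Fin.ext h2)) h3

/-- The spreading fan of cell `p`: the exponent of `u_{p,0} ⋯ u_{p,w p}`. [this file] -/
def fan (w : Fin (qOf m) × Fin (qOf m) → ℕ) (p : Fin (qOf m) × Fin (qOf m)) : ℕᵒᵈ →₀ ℕ :=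
  ∑ j ∈ Finset.range (w p + 1), Finsupp.single (toDual (enc m (p, j))) 1

/-- Spreading of exponents: `e ↦ Σ_p e_p • fan p`. [this file] -/
def spreadExp (w : Fin (qOf m) × Fin (qOf m) → ℕ) (e : (Fin (qOf m) × Fin (qOf m)) →₀ ℕ) : ℕᵒᵈ →₀ ℕ :=
  e.sum fun p n => n • fan m w p

/-- The spreading substitution `y_p ↦ u^{fan p}`. [this file] -/
def spreadVar (w : Fin (qOf m) × Fin (qOf m) → ℕ) (p : Fin (qOf m) × Fin (qOf m)) : MvPolynomial ℕᵒᵈ ℂ :=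
  monomial (fan m w p) 1

variable (w : Fin (qOf m) × Fin (qOf m) → ℕ)

/-- `spreadExp` is additive. [this file] -/
theorem spreadExp_add (e e' : (Fin (qOf m) × Fin (qOf m)) →₀ ℕ) :
    spreadExp m w (e + e') = spreadExp m w e + spreadExp m w e' :=
  Finsupp.sum_add_index' (fun _ => zero_nsmul _) fun _ _ _ => add_nsmul _ _ _

/-- `spreadExp` of a single cell. [this file] -/
theorem spreadExp_single (p : Fin (qOf m) × Fin (qOf m)) (n : ℕ) :
    spreadExp m w (Finsupp.single p n) = n • fan m w p :=
  Finsupp.sum_single_index (zero_nsmul _)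

/-- `spreadExp` of a finite sum. [this file] -/
theorem spreadExp_finsetSum {α : Type*} (s : Finset α) (g : α → (Fin (qOf m) × Fin (qOf m)) →₀ ℕ) :
    spreadExp m w (∑ a ∈ s, g a) = ∑ a ∈ s, spreadExp m w (g a) := by
  classical
  induction s using Finset.induction_on with
  | empty => simp [spreadExp]
  | insert a s ha ih => rw [Finset.sum_insert ha, Finset.sum_insert ha, spreadExp_add, ih]

/-- `deg (fan p) = w p + 1`. [this file] -/
theorem degree_fan (p : Fin (qOf m) × Fin (qOf m)) : (fan m w p).degree = w p + 1 := by
  rw [fan, map_sum]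
  simp

/-- The spreading substitution on a monomial. [this file] -/
theorem spread_monomial (e : (Fin (qOf m) × Fin (qOf m)) →₀ ℕ) (a : ℂ) :
    bind₁ (spreadVar m w) (monomial e a) = monomial (spreadExp m w e) a := by
  rw [bind₁_monomial, spreadExp, monomial_finsupp_sum_index, Finsupp.prod]
  congr 1
  exact Finset.prod_congr rfl fun p _ => by rw [spreadVar, monomial_pow, one_pow]

/-- The fan of `p'` evaluated at the `0`-th fresh variable of `p` is `[p' = p]`. [this file] -/
theorem fan_apply_enc_zero (p p' : Fin (qOf m) × Fin (qOf m)) :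
    fan m w p' (toDual (enc m (p, 0))) = if p' = p then 1 else 0 := by
  classical
  rw [fan, Finsupp.finsetSum_apply]
  simp_rw [Finsupp.single_apply, OrderDual.toDual_inj, (enc_injective m).eq_iff, Prod.mk.injEq]
  by_cases hp : p' = p
  · simp [hp]
  · simp [hp]

/-- Pull-back of spread exponents: the `u_{p,0}`-coordinate of `spreadExp e` is `e p`. [this file] -/
theorem spreadExp_apply_enc_zero (e : (Fin (qOf m) × Fin (qOf m)) →₀ ℕ) (p : Fin (qOf m) × Fin (qOf m)) :
    spreadExp m w e (toDual (enc m (p, 0))) = e p := by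
  classical
  rw [spreadExp, Finsupp.sum, Finsupp.finsetSum_apply]
  simp_rw [Finsupp.smul_apply, smul_eq_mul, fan_apply_enc_zero, mul_boole, Finset.sum_ite_eq']
  split_ifs with h
  · rfl
  · exact (Finsupp.notMem_support_iff.1 h).symm

/-- The cell pattern of the perfect matching `ρ` of block `c`: `Σ_i [E_c(ρ i, i)]`
(`= (permMonomial ρ).mapDomain E_c`). [this file] -/
def matchPattern (c : Fin 3 → Fin (qOf m)) (ρ : Equiv.Perm (Fin m)) : (Fin (qOf m) × Fin (qOf m)) →₀ ℕ :=
  Finsupp.mapDomain (cellEmb m c) (permMonomial ρ)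

/-- The `w`-weight of the perfect matching `ρ` of block `c` (cells `E_c(ρ i, i)`). [this file] -/
def matchWeight (c : Fin 3 → Fin (qOf m)) (ρ : Equiv.Perm (Fin m)) : ℕ :=
  ∑ i : Fin m, w (cellEmb m c (ρ i, i))

/-- `ρ₀` is the UNIQUE maximum-`w`-weight perfect matching of block `c`. [this file] -/
def IsUniqueMaxMatching (c : Fin 3 → Fin (qOf m)) (ρ₀ : Equiv.Perm (Fin m)) : Prop :=
  ∀ ρ : Equiv.Perm (Fin m), ρ ≠ ρ₀ → matchWeight m w c ρ < matchWeight m w c ρ₀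

/-- The spread exponent of the matching `ρ` of block `c`. [this file] -/
def spreadPat (c : Fin 3 → Fin (qOf m)) (ρ : Equiv.Perm (Fin m)) : ℕᵒᵈ →₀ ℕ :=
  spreadExp m w (matchPattern m c ρ)

/-- The pattern as a sum of cell indicators. [folklore] -/
theorem matchPattern_eq_sum (c : Fin 3 → Fin (qOf m)) (ρ : Equiv.Perm (Fin m)) :
    matchPattern m c ρ = ∑ i : Fin m, Finsupp.single (cellEmb m c (ρ i, i)) 1 := by
  rw [matchPattern, permMonomial, Finsupp.mapDomain_finsetSum]
  simp_rw [Finsupp.mapDomain_single]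

/-- The spread pattern as a sum of fans. [this file] -/
theorem spreadPat_eq_sum (c : Fin 3 → Fin (qOf m)) (ρ : Equiv.Perm (Fin m)) :
    spreadPat m w c ρ = ∑ i : Fin m, fan m w (cellEmb m c (ρ i, i)) := by
  rw [spreadPat, matchPattern_eq_sum, spreadExp_finsetSum]
  simp_rw [spreadExp_single, one_nsmul]

/-- `deg (spreadPat c ρ) = w(M_ρ) + m`. [this file] -/
theorem degree_spreadPat (c : Fin 3 → Fin (qOf m)) (ρ : Equiv.Perm (Fin m)) :
    (spreadPat m w c ρ).degree = matchWeight m w c ρ + m := by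
  rw [spreadPat_eq_sum, map_sum]
  simp_rw [degree_fan]
  rw [Finset.sum_add_distrib, matchWeight]
  simp

/-- The `u_{p,0}`-coordinate of the spread pattern is the pattern. [this file] -/
theorem spreadPat_apply_enc_zero (c : Fin 3 → Fin (qOf m)) (ρ : Equiv.Perm (Fin m))
    (p : Fin (qOf m) × Fin (qOf m)) : spreadPat m w c ρ (toDual (enc m (p, 0))) = matchPattern m c ρ p :=
  spreadExp_apply_enc_zero m w _ p

/-- `G_m(c) = Σ_ρ y^{M_ρ}` (block permanent as a sum of pattern monomials). [folklore] -/
theorem kiPer_eq_sum_matchPattern (c : Fin 3 → Fin (qOf m)) :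
    kiPer m c = ∑ ρ : Equiv.Perm (Fin m), monomial (matchPattern m c ρ) 1 := by
  rw [kiPer_eq_rename_cellEmb, perPoly_eq_sum_monomial, map_sum]
  simp_rw [rename_monomial]
  rfl

/-- The spread block permanent is the sum of the spread pattern monomials. [this file] -/
theorem spread_kiPer (c : Fin 3 → Fin (qOf m)) :
    bind₁ (spreadVar m w) (kiPer m c) = ∑ ρ : Equiv.Perm (Fin m), monomial (spreadPat m w c ρ) 1 := by
  rw [kiPer_eq_sum_matchPattern, map_sum]
  simp_rw [spread_monomial]
  rfl

/-- The spread block permanent is nonzero (permanent positivity: all coefficients are `≥ 0` integers and the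
coefficient of the spread identity pattern is `≥ 1`). [this file] -/
theorem spread_kiPer_ne_zero (c : Fin 3 → Fin (qOf m)) : bind₁ (spreadVar m w) (kiPer m c) ≠ 0 := by
  classical
  intro h0
  have h1 : coeff (spreadPat m w c 1) (bind₁ (spreadVar m w) (kiPer m c)) = 0 := by rw [h0, coeff_zero]
  rw [spread_kiPer, coeff_sum] at h1
  simp_rw [coeff_monomial] at h1
  rw [Finset.sum_boole, Nat.cast_eq_zero, Finset.card_eq_zero, Finset.filter_eq_empty_iff] at h1
  exact h1 (Finset.mem_univ 1) rfl

/-- Deg-lex compares by degree first. [folklore] -/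
theorem degLex_lt_of_degree_lt {X : Type*} [LinearOrder X] [WellFoundedGT X] {a b : X →₀ ℕ}
    (h : a.degree < b.degree) :
    (MonomialOrder.degLex (σ := X)).toSyn a < (MonomialOrder.degLex (σ := X)).toSyn b := by
  change toDegLex a < toDegLex b
  rw [Finsupp.DegLex.lt_iff]
  exact Or.inl h

/-- **Leading exponent of a spread block permanent** under deg-lex = the spread pattern of the unique
maximum-weight matching. [this file] -/
theorem degree_spread_kiPer (c : Fin 3 → Fin (qOf m)) (ρ₀ : Equiv.Perm (Fin m))
    (hρ₀ : IsUniqueMaxMatching m w c ρ₀) :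
    (MonomialOrder.degLex (σ := ℕᵒᵈ)).degree (bind₁ (spreadVar m w) (kiPer m c)) = spreadPat m w c ρ₀ := by
  classical
  have hlt : ∀ ρ, ρ ≠ ρ₀ → (MonomialOrder.degLex (σ := ℕᵒᵈ)).toSyn (spreadPat m w c ρ) <
      (MonomialOrder.degLex (σ := ℕᵒᵈ)).toSyn (spreadPat m w c ρ₀) := fun ρ hρ =>
    degLex_lt_of_degree_lt (by rw [degree_spreadPat, degree_spreadPat]; exact Nat.add_lt_add_right (hρ₀ ρ hρ) m)
  apply (MonomialOrder.degLex (σ := ℕᵒᵈ)).toSyn.injective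
  apply le_antisymm
  · apply (MonomialOrder.degLex (σ := ℕᵒᵈ)).degree_le_iff.2
    intro b hb
    rw [spread_kiPer] at hb
    obtain ⟨ρ, -, hρ⟩ := Finset.mem_biUnion.1 (support_sum hb)
    have hb' : b = spreadPat m w c ρ := Finset.mem_singleton.1 (support_monomial_subset hρ)
    rw [hb']
    by_cases h : ρ = ρ₀
    · rw [h]
    · exact (hlt ρ h).le
  · apply (MonomialOrder.degLex (σ := ℕᵒᵈ)).le_degree
    rw [mem_support_iff, spread_kiPer, coeff_sum]
    simp_rw [coeff_monomial]
    rw [Finset.sum_eq_single ρ₀]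
    · simp
    · intro ρ _ hρ
      rw [if_neg]
      intro h
      exact (hlt ρ hρ).ne (by rw [h])
    · exact fun h => absurd (Finset.mem_univ ρ₀) h

/-- **WEIGHT CERTIFICATE ⟹ HITTING.** If every block `c ∈ T` has a unique maximum-`w`-weight matching `σ c`
and the patterns `(M_{σ c})_{c ∈ T}` admit NO nonzero integer trade of positive mass `≤ d`, then every nonzero
`D` with monomials in `T` and `deg D ≤ d` has `D ∘ G_m ≠ 0`. [this file] -/
theorem kiPer_hits_of_noShortTrade_weight (T : Finset (Fin 3 → Fin (qOf m)))
    (σ : (Fin 3 → Fin (qOf m)) → Equiv.Perm (Fin m)) (hσ : ∀ c ∈ T, IsUniqueMaxMatching m w c (σ c)) (d : ℕ)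
    (hno : ∀ γ : (Fin 3 → Fin (qOf m)) → ℤ, (∀ c, c ∉ T → γ c = 0) → γ ≠ 0 →
      (∀ p : Fin (qOf m) × Fin (qOf m), ∑ c ∈ T, γ c * (matchPattern m c (σ c) p : ℤ) = 0) →
      d < ∑ c ∈ T, (γ c).toNat)
    (D : MvPolynomial (Fin 3 → Fin (qOf m)) ℂ) (hD : D ≠ 0) (hT : ∀ e ∈ D.support, e.support ⊆ T)
    (hdeg : D.totalDegree ≤ d) : bind₁ (kiPer m) D ≠ 0 := by
  classical
  let P : (Fin 3 → Fin (qOf m)) → MvPolynomial ℕᵒᵈ ℂ := fun c => bind₁ (spreadVar m w) (kiPer m c)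
  have hP : ∀ c, P c ≠ 0 := fun c => spread_kiPer_ne_zero m w c
  have hdegT : ∀ c ∈ T, (MonomialOrder.degLex (σ := ℕᵒᵈ)).degree (P c) = spreadPat m w c (σ c) :=
    fun c hc => degree_spread_kiPer m w c (σ c) (hσ c hc)
  have hno' : ∀ γ : (Fin 3 → Fin (qOf m)) → ℤ, (∀ c, c ∉ T → γ c = 0) → γ ≠ 0 →
      (∀ x : ℕᵒᵈ, ∑ c ∈ T, γ c * ((MonomialOrder.degLex (σ := ℕᵒᵈ)).degree (P c) x : ℤ) = 0) →
      d < ∑ c ∈ T, (γ c).toNat := by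
    intro γ hγT hγ0 hx
    refine hno γ hγT hγ0 fun p => ?_
    rw [← hx (toDual (enc m (p, 0)))]
    refine Finset.sum_congr rfl fun c hc => ?_
    rw [hdegT c hc, spreadPat_apply_enc_zero]
  have hhit := hits_of_noShortTrade (MonomialOrder.degLex (σ := ℕᵒᵈ)) P hP T d hno' D hD hT hdeg
  intro h0
  apply hhit
  show bind₁ (fun c => bind₁ (spreadVar m w) (kiPer m c)) D = 0
  rw [← bind₁_bind₁, h0, map_zero]

/-- **Weight certificate on `vars D` ⟹ hitting** (`T := vars D`). [this file] -/
theorem kiPer_hits_of_weightCert_vars (σ : (Fin 3 → Fin (qOf m)) → Equiv.Perm (Fin m)) (d : ℕ)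
    (D : MvPolynomial (Fin 3 → Fin (qOf m)) ℂ) (hD : D ≠ 0)
    (hσ : ∀ c ∈ D.vars, IsUniqueMaxMatching m w c (σ c))
    (hno : ∀ γ : (Fin 3 → Fin (qOf m)) → ℤ, (∀ c, c ∉ D.vars → γ c = 0) → γ ≠ 0 →
      (∀ p : Fin (qOf m) × Fin (qOf m), ∑ c ∈ D.vars, γ c * (matchPattern m c (σ c) p : ℤ) = 0) →
      d < ∑ c ∈ D.vars, (γ c).toNat)
    (hdeg : D.totalDegree ≤ d) : bind₁ (kiPer m) D ≠ 0 :=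
  kiPer_hits_of_noShortTrade_weight m w D.vars σ hσ d hno D hD
    (fun e he i hi => (mem_vars_iff_mem_support i).2 ⟨e, he, hi⟩) hdeg

end Weight

/-! ## 3. The trade certificate as a predicate, and the glue to support hitting -/

section Cert

/-- **TRADE CERTIFICATE at (`m`; support `s`, degree `d`)**: every `T` with `|T| ≤ s` admits a cell weight
with unique maximum-weight matchings whose patterns have NO nonzero trade of positive mass `≤ d`. [this file] -/
def TradeCertAt (m s d : ℕ) : Prop :=
  ∀ T : Finset (Fin 3 → Fin (qOf m)), T.card ≤ s →
    ∃ (w : Fin (qOf m) × Fin (qOf m) → ℕ) (σ : (Fin 3 → Fin (qOf m)) → Equiv.Perm (Fin m)),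
      (∀ c ∈ T, IsUniqueMaxMatching m w c (σ c)) ∧
      ∀ γ : (Fin 3 → Fin (qOf m)) → ℤ, (∀ c, c ∉ T → γ c = 0) → γ ≠ 0 →
        (∀ p : Fin (qOf m) × Fin (qOf m), ∑ c ∈ T, γ c * (matchPattern m c (σ c) p : ℤ) = 0) →
        d < ∑ c ∈ T, (γ c).toNat

/-- **Trade certificate ⟹ support hitting at `m`**: every nonzero `D` on `≤ s` blocks of degree `≤ d` is hit by
`G_m`. [this file] -/
theorem hits_of_tradeCertAt {m s d : ℕ} (h : TradeCertAt m s d)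
    (D : MvPolynomial (Fin 3 → Fin (qOf m)) ℂ) (hD : D ≠ 0) (hvars : D.vars.card ≤ s)
    (hdeg : D.totalDegree ≤ d) : bind₁ (kiPer m) D ≠ 0 := by
  obtain ⟨w, σ, hσ, hno⟩ := h D.vars hvars
  exact kiPer_hits_of_weightCert_vars m w σ d D hD hσ hno hdeg

/-- **GLUE to the support road (i.o. form)**: trade certificates at `(s m, d m)` for infinitely many `m` ⟹
support hitting i.o.; with `s m = 2q²+1`, `d m = q²` the conclusion is the lens node's `KISupportHitting 2`.
[this file] -/
theorem supportHitting_of_tradeCert (s d : ℕ → ℕ) (h : ∀ m₀ : ℕ, ∃ m, m₀ ≤ m ∧ TradeCertAt m (s m) (d m)) :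
    ∀ m₀ : ℕ, ∃ m, m₀ ≤ m ∧ ∀ D : MvPolynomial (Fin 3 → Fin (qOf m)) ℂ, D ≠ 0 →
      D.vars.card ≤ s m → D.totalDegree ≤ d m → bind₁ (kiPer m) D ≠ 0 := by
  intro m₀
  obtain ⟨m, hm, hc⟩ := h m₀
  exact ⟨m, hm, fun D hD hv hdeg => hits_of_tradeCertAt hc D hD hv hdeg⟩

end Cert

end Summit.ValiantsHypothesis.ValiantsHypothesis.Theorems.DefinabilityGapTradeCertificate

end
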